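import Literature.Analysis.UnboundedOperators.HilleYosidaApproximants
import Literature.Analysis.UnboundedOperators.StrongContRepresentation
import HarnessLib

/-!
# The Hille–Yosida generation theorem (contraction case), part 2: the semigroup as the strong
  limit of the exponentials of the Yosida approximants

Analysis/UnboundedOperators support file (two definitions with bodies, everything proved, no
named facts), continuing `HilleYosidaApproximants.lean` (Engel–Nagel (2000), Ch. II Thm. 3.5,
second half of the proof; Pazy (1983), Thm. 1.3.1). For Hille–Yosida data `h : IsHilleYosidaData U J`
on a complex Banach space `E` (a pseudo-resolvent `J` on `U ⊇ (0, ∞)` with `‖J(λ)‖ ≤ 1/λ` and dense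
range) and the Yosida approximants `Y_λ = λ²J(λ) − λ`:

* §1 `cauchySeq_exp_yosida_apply`: for every `x ∈ E` and `t ≥ 0` the net
  `λ ↦ exp (tY_λ) x` is Cauchy as `λ → ∞` (on the dense range by the key estimate
  `‖exp (tY_λ)x − exp (tY_μ)x‖ ≤ t‖Y_λ x − Y_μ x‖` and convergence of `Y_λ x`; in general by
  density and `‖exp (tY_λ)‖ ≤ 1`), hence converges (`E` complete): **`semigroupFun h t x := lim`**,
  `tendsto_semigroupFun`;
* §2 the limit is linear and contractive in `x`, `= x` at `t = 0`, and satisfies the semigroup law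
  (limits of `exp ((s + t)Y_λ) = exp (sY_λ) exp (tY_λ)`);
* §3 strong continuity: `‖T(t)x − x‖ ≤ t‖x − y‖` for `x = J(1)y`, hence `T(t)x → x` as `t ↓ 0`
  for all `x` by density, hence continuity on `[0, ∞)` by the semigroup law and contractivity;
* §4 **`IsHilleYosidaData.semigroup h : C0Semigroup ℂ E`** (the tree's
  `StrongContRepresentation` of `Multiplicative ℝ≥0`), with `‖T(t)‖ ≤ 1` (`isContraction_semigroup`)
  in the shape `‖T(t)‖ ≤ 1 · e^{0·t}` consumed by the Laplace bridge
  (`C0Semigroup.laplaceResolvent`, `SemigroupLaplaceResolvent*.lean`).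

Part 3 (`HilleYosidaGenerator.lean`) shows that the Laplace transform of this semigroup is `J`,
i.e. that its generator is `operatorOfResolvent J` — the content of the generation theorem.

## References

* K.-J. Engel, R. Nagel, *One-Parameter Semigroups for Linear Evolution Equations* (2000),
  Ch. II Thm. 3.5 and its proof, (3.7)–(3.10). [EngelNagel2000]
* A. Pazy, *Semigroups of Linear Operators and Applications to PDE* (1983), Thm. 1.3.1.
* T. Kato, *Perturbation Theory for Linear Operators* (1966), IX-§1.2. [Kato1966]
-/

noncomputable section

open NormedSpace Filter Set Metric Literature.Analysis.OperatorTheory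
open scoped Topology NNReal

namespace Literature.Analysis.UnboundedOperators

namespace HilleYosida

namespace IsHilleYosidaData

variable {E : Type*} [NormedAddCommGroup E] [NormedSpace ℂ E] [CompleteSpace E]
variable {U : Set ℂ} {J : ℂ → E →L[ℂ] E}

/-! ### §1 The strong limit of `exp (tY_λ)` as `λ → ∞` -/

/-- On the dense range the net `λ ↦ exp (tY_λ) (J(1)y)` is Cauchy (`λ → ∞`): by the key estimate
its oscillation is at most `t` times that of the convergent net `Y_λ (J(1)y)`.
[cite: EngelNagel2000, Ch. II Thm. 3.5 proof, (3.9)] -/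
theorem cauchySeq_exp_yosida_apply_of_mem (h : IsHilleYosidaData U J) {t : ℝ} (ht : 0 ≤ t) (y : E) :
    CauchySeq fun l : ℝ => exp ((t : ℂ) • yosida J l) (J 1 y) := by
  have hY : CauchySeq fun l : ℝ => yosida J l (J 1 y) := (h.tendsto_yosida_apply_resolvent y).cauchySeq
  rw [Metric.cauchySeq_iff] at hY ⊢
  intro ε hε
  obtain ⟨N, hN⟩ := hY (ε / (t + 1)) (by positivity)
  refine ⟨max N 1, fun l hl m hm => ?_⟩
  have hl0 : 0 < l := one_pos.trans_le ((le_max_right _ _).trans hl)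
  have hm0 : 0 < m := one_pos.trans_le ((le_max_right _ _).trans hm)
  have hd := hN l ((le_max_left _ _).trans hl) m ((le_max_left _ _).trans hm)
  rw [dist_eq_norm] at hd ⊢
  calc ‖exp ((t : ℂ) • yosida J l) (J 1 y) - exp ((t : ℂ) • yosida J m) (J 1 y)‖
      ≤ t * ‖yosida J l (J 1 y) - yosida J m (J 1 y)‖ := h.norm_exp_yosida_sub_le hl0 hm0 ht _
    _ ≤ t * (ε / (t + 1)) := mul_le_mul_of_nonneg_left hd.le ht
    _ < ε := by
        rw [mul_div_assoc', div_lt_iff₀ (by positivity)]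
        nlinarith

/-- **For every `x` the net `λ ↦ exp (tY_λ) x` is Cauchy** (`t ≥ 0`): density of the range and the
uniform bound `‖exp (tY_λ)‖ ≤ 1`. [cite: EngelNagel2000, Ch. II Thm. 3.5 proof, (3.10)] -/
theorem cauchySeq_exp_yosida_apply (h : IsHilleYosidaData U J) {t : ℝ} (ht : 0 ≤ t) (x : E) :
    CauchySeq fun l : ℝ => exp ((t : ℂ) • yosida J l) x := by
  rw [Metric.cauchySeq_iff]
  intro ε hε
  obtain ⟨x', hx'mem, hx'⟩ : ∃ x' ∈ Set.range (J 1), dist x x' < ε / 3 :=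
    Metric.mem_closure_iff.1 (h.dense x) (ε / 3) (by positivity)
  obtain ⟨y, rfl⟩ := hx'mem
  have hc := h.cauchySeq_exp_yosida_apply_of_mem ht y
  rw [Metric.cauchySeq_iff] at hc
  obtain ⟨N, hN⟩ := hc (ε / 3) (by positivity)
  refine ⟨max N 1, fun l hl m hm => ?_⟩
  have hl0 : 0 < l := one_pos.trans_le ((le_max_right _ _).trans hl)
  have hm0 : 0 < m := one_pos.trans_le ((le_max_right _ _).trans hm)
  have hd := hN l ((le_max_left _ _).trans hl) m ((le_max_left _ _).trans hm)
  rw [dist_eq_norm] at hd hx' ⊢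
  have h1 : ‖exp ((t : ℂ) • yosida J l) (x - J 1 y)‖ ≤ ‖x - J 1 y‖ := h.norm_exp_yosida_apply_le hl0 ht _
  have h2 : ‖exp ((t : ℂ) • yosida J m) (x - J 1 y)‖ ≤ ‖x - J 1 y‖ := h.norm_exp_yosida_apply_le hm0 ht _
  calc ‖exp ((t : ℂ) • yosida J l) x - exp ((t : ℂ) • yosida J m) x‖
      = ‖exp ((t : ℂ) • yosida J l) (x - J 1 y)
          + (exp ((t : ℂ) • yosida J l) (J 1 y) - exp ((t : ℂ) • yosida J m) (J 1 y))
          - exp ((t : ℂ) • yosida J m) (x - J 1 y)‖ := by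
        congr 1; simp only [map_sub]; abel
    _ ≤ ‖exp ((t : ℂ) • yosida J l) (x - J 1 y)‖
          + ‖exp ((t : ℂ) • yosida J l) (J 1 y) - exp ((t : ℂ) • yosida J m) (J 1 y)‖
          + ‖exp ((t : ℂ) • yosida J m) (x - J 1 y)‖ := norm_sub_le_of_le (norm_add_le _ _) le_rfl
    _ < ε / 3 + ε / 3 + ε / 3 :=
        add_lt_add_of_lt_of_le (add_lt_add_of_le_of_lt (h1.trans hx'.le) hd) (h2.trans hx'.le)
    _ = ε := by ring

/-- **The candidate semigroup** `T(t)x := lim_{λ → ∞} exp (tY_λ) x` (Engel–Nagel (3.10); a junk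
limit for `t < 0`, where nothing is claimed). [cite: EngelNagel2000, Ch. II Thm. 3.5 proof, (3.10)] -/
def semigroupFun (_h : IsHilleYosidaData U J) (t : ℝ) (x : E) : E :=
  limUnder atTop fun l : ℝ => exp ((t : ℂ) • yosida J l) x

/-- **`exp (tY_λ) x → T(t)x` as `λ → ∞`** (`t ≥ 0`). [cite: EngelNagel2000, Ch. II Thm. 3.5 proof, (3.10)] -/
theorem tendsto_semigroupFun (h : IsHilleYosidaData U J) {t : ℝ} (ht : 0 ≤ t) (x : E) :
    Tendsto (fun l : ℝ => exp ((t : ℂ) • yosida J l) x) atTop (𝓝 (h.semigroupFun t x)) :=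
  tendsto_nhds_limUnder (cauchySeq_tendsto_of_complete (h.cauchySeq_exp_yosida_apply ht x))

/-! ### §2 Linearity, contractivity, the semigroup law -/

/-- `T(t)` is additive. [cite: EngelNagel2000, Ch. II Thm. 3.5 proof] -/
theorem semigroupFun_add (h : IsHilleYosidaData U J) {t : ℝ} (ht : 0 ≤ t) (x y : E) :
    h.semigroupFun t (x + y) = h.semigroupFun t x + h.semigroupFun t y := by
  refine tendsto_nhds_unique (h.tendsto_semigroupFun ht (x + y)) ?_
  simpa only [map_add] using (h.tendsto_semigroupFun ht x).add (h.tendsto_semigroupFun ht y)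

/-- `T(t)` is homogeneous. [cite: EngelNagel2000, Ch. II Thm. 3.5 proof] -/
theorem semigroupFun_smul (h : IsHilleYosidaData U J) {t : ℝ} (ht : 0 ≤ t) (c : ℂ) (x : E) :
    h.semigroupFun t (c • x) = c • h.semigroupFun t x := by
  refine tendsto_nhds_unique (h.tendsto_semigroupFun ht (c • x)) ?_
  simpa only [map_smul] using (h.tendsto_semigroupFun ht x).const_smul c

/-- `T(t)(x − y) = T(t)x − T(t)y`. [cite: EngelNagel2000, Ch. II Thm. 3.5 proof] -/
theorem semigroupFun_sub (h : IsHilleYosidaData U J) {t : ℝ} (ht : 0 ≤ t) (x y : E) :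
    h.semigroupFun t (x - y) = h.semigroupFun t x - h.semigroupFun t y := by
  refine tendsto_nhds_unique (h.tendsto_semigroupFun ht (x - y)) ?_
  simpa only [map_sub] using (h.tendsto_semigroupFun ht x).sub (h.tendsto_semigroupFun ht y)

/-- **`‖T(t)x‖ ≤ ‖x‖`**. [cite: EngelNagel2000, Ch. II Thm. 3.5 proof] -/
theorem norm_semigroupFun_le (h : IsHilleYosidaData U J) {t : ℝ} (ht : 0 ≤ t) (x : E) :
    ‖h.semigroupFun t x‖ ≤ ‖x‖ := by
  refine le_of_tendsto (h.tendsto_semigroupFun ht x).norm ?_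
  filter_upwards [eventually_gt_atTop (0 : ℝ)] with l hl
  exact h.norm_exp_yosida_apply_le hl ht x

/-- `T(0) = 1`. [cite: EngelNagel2000, Ch. II Thm. 3.5 proof] -/
theorem semigroupFun_zero (h : IsHilleYosidaData U J) (x : E) : h.semigroupFun 0 x = x := by
  refine tendsto_nhds_unique (h.tendsto_semigroupFun le_rfl x) ?_
  simp only [Complex.ofReal_zero, zero_smul, exp_zero, one_apply_eq_self]
  exact tendsto_const_nhds

/-- `exp ((s + t)Y) = exp (sY) ∘ exp (tY)` applied to a vector. [cite: EngelNagel2000, Ch. I Prop. 3.5] -/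
theorem exp_add_smul_apply (Y : E →L[ℂ] E) (s t : ℝ) (x : E) :
    exp (((s + t : ℝ) : ℂ) • Y) x = exp ((s : ℂ) • Y) (exp ((t : ℂ) • Y) x) := by
  letI : NormedAlgebra ℚ (E →L[ℂ] E) := .restrictScalars ℚ ℂ _
  have hc : Commute ((s : ℂ) • Y) ((t : ℂ) • Y) := ((Commute.refl Y).smul_left _).smul_right _
  rw [Complex.ofReal_add, add_smul, exp_add_of_commute hc, mul_apply_eq_comp]

/-- **The semigroup law** `T(s + t)x = T(s)(T(t)x)` (`s, t ≥ 0`): pass to the limit in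
`exp ((s + t)Y_λ)x = exp (sY_λ)(exp (tY_λ)x)` using `‖exp (sY_λ)‖ ≤ 1`.
[cite: EngelNagel2000, Ch. II Thm. 3.5 proof] -/
theorem semigroupFun_add_time (h : IsHilleYosidaData U J) {s t : ℝ} (hs : 0 ≤ s) (ht : 0 ≤ t) (x : E) :
    h.semigroupFun (s + t) x = h.semigroupFun s (h.semigroupFun t x) := by
  refine tendsto_nhds_unique (h.tendsto_semigroupFun (add_nonneg hs ht) x) ?_
  -- `exp(sY_λ)(exp(tY_λ)x) → T(s)(T(t)x)`
  set z := h.semigroupFun t x with hz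
  have h1 : Tendsto (fun l : ℝ => exp ((s : ℂ) • yosida J l) z) atTop (𝓝 (h.semigroupFun s z)) :=
    h.tendsto_semigroupFun hs z
  have h2 : Tendsto (fun l : ℝ => ‖exp ((t : ℂ) • yosida J l) x - z‖) atTop (𝓝 0) := by
    have := (h.tendsto_semigroupFun ht x).sub_const z
    rw [sub_self] at this
    exact tendsto_norm_zero.comp this
  rw [tendsto_iff_norm_sub_tendsto_zero]
  have h3 : Tendsto (fun l : ℝ => ‖exp ((t : ℂ) • yosida J l) x - z‖
      + ‖exp ((s : ℂ) • yosida J l) z - h.semigroupFun s z‖) atTop (𝓝 0) := by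
    have := h2.add (tendsto_iff_norm_sub_tendsto_zero.1 h1)
    rwa [add_zero] at this
  refine squeeze_zero' (Eventually.of_forall fun l => norm_nonneg _) ?_ h3
  filter_upwards [eventually_gt_atTop (0 : ℝ)] with l hl
  rw [exp_add_smul_apply]
  calc ‖exp ((s : ℂ) • yosida J l) (exp ((t : ℂ) • yosida J l) x) - h.semigroupFun s z‖
      = ‖exp ((s : ℂ) • yosida J l) (exp ((t : ℂ) • yosida J l) x - z)
          + (exp ((s : ℂ) • yosida J l) z - h.semigroupFun s z)‖ := by
        congr 1; rw [map_sub]; abel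
    _ ≤ ‖exp ((s : ℂ) • yosida J l) (exp ((t : ℂ) • yosida J l) x - z)‖
          + ‖exp ((s : ℂ) • yosida J l) z - h.semigroupFun s z‖ := norm_add_le _ _
    _ ≤ ‖exp ((t : ℂ) • yosida J l) x - z‖ + ‖exp ((s : ℂ) • yosida J l) z - h.semigroupFun s z‖ :=
        add_le_add (h.norm_exp_yosida_apply_le hl hs _) le_rfl

/-! ### §3 Strong continuity -/

/-- On the dense range: `‖T(t)(J(1)y) − J(1)y‖ ≤ t ‖J(1)y − y‖` (limit of
`‖exp (tY_λ)x − x‖ ≤ t‖Y_λ x‖ ≤ t‖Ax‖`). [cite: EngelNagel2000, Ch. II Thm. 3.5 proof] -/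
theorem norm_semigroupFun_sub_self_le_of_mem (h : IsHilleYosidaData U J) {t : ℝ} (ht : 0 ≤ t) (y : E) :
    ‖h.semigroupFun t (J 1 y) - J 1 y‖ ≤ t * ‖J 1 y - y‖ := by
  have hlim := ((h.tendsto_semigroupFun ht (J 1 y)).sub_const (J 1 y)).norm
  refine le_of_tendsto hlim ?_
  filter_upwards [eventually_gt_atTop (0 : ℝ)] with l hl
  exact (h.norm_exp_yosida_apply_sub_self_le hl ht _).trans
    (mul_le_mul_of_nonneg_left (h.norm_yosida_apply_resolvent_le hl y) ht)

/-- **`T(t)x → x` as `t ↓ 0`, for every `x`** (in `ε`–`δ` form): density of the range, the estimate on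
the range and `‖T(t)‖ ≤ 1`. [cite: EngelNagel2000, Ch. II Thm. 3.5 proof] -/
theorem exists_norm_semigroupFun_sub_self_lt (h : IsHilleYosidaData U J) (x : E) {ε : ℝ} (hε : 0 < ε) :
    ∃ δ > 0, ∀ t : ℝ, 0 ≤ t → t < δ → ‖h.semigroupFun t x - x‖ < ε := by
  obtain ⟨x', hx'mem, hx'⟩ : ∃ x' ∈ Set.range (J 1), dist x x' < ε / 3 :=
    Metric.mem_closure_iff.1 (h.dense x) (ε / 3) (by positivity)
  obtain ⟨y, rfl⟩ := hx'mem
  set C : ℝ := ‖J 1 y - y‖ with hC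
  refine ⟨ε / (3 * (C + 1)), by positivity, fun t ht0 htδ => ?_⟩
  rw [dist_eq_norm] at hx'
  have h1 : ‖h.semigroupFun t (x - J 1 y)‖ ≤ ‖x - J 1 y‖ := h.norm_semigroupFun_le ht0 _
  have h2 : ‖h.semigroupFun t (J 1 y) - J 1 y‖ ≤ t * C := h.norm_semigroupFun_sub_self_le_of_mem ht0 y
  have h3 : t * C < ε / 3 := by
    have hC0 : 0 ≤ C := norm_nonneg _
    calc t * C ≤ ε / (3 * (C + 1)) * C := mul_le_mul_of_nonneg_right htδ.le hC0
      _ < ε / 3 := by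
          rw [div_mul_eq_mul_div, div_lt_div_iff₀ (by positivity) (by positivity)]
          nlinarith
  calc ‖h.semigroupFun t x - x‖
      = ‖h.semigroupFun t (x - J 1 y) + (h.semigroupFun t (J 1 y) - J 1 y) + (J 1 y - x)‖ := by
        rw [h.semigroupFun_sub ht0]; congr 1; abel
    _ ≤ ‖h.semigroupFun t (x - J 1 y)‖ + ‖h.semigroupFun t (J 1 y) - J 1 y‖ + ‖J 1 y - x‖ :=
        norm_add₃_le
    _ < ε / 3 + ε / 3 + ε / 3 :=
        add_lt_add (add_lt_add_of_le_of_lt (h1.trans hx'.le) (h2.trans_lt h3)) (by rwa [norm_sub_rev])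
    _ = ε := by ring

/-- **Strong continuity**: `t ↦ T(t)x` is continuous on `[0, ∞)` (right/left increments are
`T(t₀)(T(τ)x − x)`, `T(t)(x − T(τ)x)` with `τ` small, and `‖T(·)‖ ≤ 1`).
[cite: EngelNagel2000, Ch. II Thm. 3.5 proof] -/
theorem continuous_semigroupFun (h : IsHilleYosidaData U J) (x : E) :
    Continuous fun t : ℝ≥0 => h.semigroupFun (t : ℝ) x := by
  rw [Metric.continuous_iff]
  intro t₀ ε hε
  obtain ⟨δ, hδ, hsmall⟩ := h.exists_norm_semigroupFun_sub_self_lt x hε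
  refine ⟨δ, hδ, fun t hdist => ?_⟩
  rw [NNReal.dist_eq] at hdist
  rw [dist_eq_norm]
  rcases le_total t₀ t with hle | hle
  · have hτ0 : 0 ≤ (t : ℝ) - t₀ := sub_nonneg.2 (NNReal.coe_le_coe.2 hle)
    have hτδ : (t : ℝ) - t₀ < δ := by rwa [abs_of_nonneg hτ0] at hdist
    have hsplit : h.semigroupFun (t : ℝ) x = h.semigroupFun (t₀ : ℝ) (h.semigroupFun ((t : ℝ) - t₀) x) := by
      rw [← h.semigroupFun_add_time t₀.coe_nonneg hτ0, add_sub_cancel]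
    rw [hsplit, ← h.semigroupFun_sub t₀.coe_nonneg]
    exact (h.norm_semigroupFun_le t₀.coe_nonneg _).trans_lt (hsmall _ hτ0 hτδ)
  · have hτ0 : 0 ≤ (t₀ : ℝ) - t := sub_nonneg.2 (NNReal.coe_le_coe.2 hle)
    have hτδ : (t₀ : ℝ) - t < δ := by
      rw [abs_sub_comm, abs_of_nonneg hτ0] at hdist; exact hdist
    have hsplit : h.semigroupFun (t₀ : ℝ) x = h.semigroupFun (t : ℝ) (h.semigroupFun ((t₀ : ℝ) - t) x) := by
      rw [← h.semigroupFun_add_time t.coe_nonneg hτ0, add_sub_cancel]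
    rw [hsplit, ← h.semigroupFun_sub t.coe_nonneg]
    refine (h.norm_semigroupFun_le t.coe_nonneg _).trans_lt ?_
    rw [norm_sub_rev]
    exact hsmall _ hτ0 hτδ

/-! ### §4 The C₀-semigroup -/

/-- `T(t)` as a bounded operator, `‖T(t)‖ ≤ 1`. [cite: EngelNagel2000, Ch. II Thm. 3.5] -/
def semigroupCLM (h : IsHilleYosidaData U J) (t : ℝ≥0) : E →L[ℂ] E :=
  LinearMap.mkContinuous
    { toFun := h.semigroupFun t
      map_add' := h.semigroupFun_add t.coe_nonneg
      map_smul' := h.semigroupFun_smul t.coe_nonneg }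
    1 fun x => by rw [one_mul]; exact h.norm_semigroupFun_le t.coe_nonneg x

/-- `semigroupCLM` acts as `semigroupFun`. [cite: EngelNagel2000, Ch. II Thm. 3.5] -/
theorem semigroupCLM_apply (h : IsHilleYosidaData U J) (t : ℝ≥0) (x : E) :
    h.semigroupCLM t x = h.semigroupFun t x := rfl

/-- **The Hille–Yosida semigroup** of the data `h`: the strong limit `T(t) = lim_{λ→∞} exp (tY_λ)`
as a C₀-semigroup on `E` (`T(0) = 1`, `T(s + t) = T(s)T(t)`, strongly continuous).
[cite: EngelNagel2000, Ch. II Thm. 3.5] -/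
def semigroup (h : IsHilleYosidaData U J) : C0Semigroup ℂ E where
  toMonoidHom :=
    { toFun := fun g => h.semigroupCLM (Multiplicative.toAdd g)
      map_one' := by
        ext x
        rw [toAdd_one, semigroupCLM_apply, NNReal.coe_zero, semigroupFun_zero, one_apply_eq_self]
      map_mul' := fun a b => by
        ext x
        rw [toAdd_mul, semigroupCLM_apply, mul_apply_eq_comp, semigroupCLM_apply, semigroupCLM_apply,
          NNReal.coe_add, h.semigroupFun_add_time (Multiplicative.toAdd a).coe_nonneg
            (Multiplicative.toAdd b).coe_nonneg] }
  strongly_continuous := fun x => (h.continuous_semigroupFun x).comp continuous_toAdd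

/-- `T(t)x = lim_{λ→∞} exp (tY_λ) x` (unfolding). [cite: EngelNagel2000, Ch. II Thm. 3.5] -/
theorem semigroup_app (h : IsHilleYosidaData U J) (t : ℝ≥0) (x : E) :
    h.semigroup.app t x = h.semigroupFun t x := rfl

/-- **`exp (tY_λ) x → T(t)x` as `λ → ∞`** (Engel–Nagel (3.10)).
[cite: EngelNagel2000, Ch. II Thm. 3.5 proof, (3.10)] -/
theorem tendsto_semigroup_app (h : IsHilleYosidaData U J) (t : ℝ≥0) (x : E) :
    Tendsto (fun l : ℝ => exp (((t : ℝ) : ℂ) • yosida J l) x) atTop (𝓝 (h.semigroup.app t x)) :=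
  h.tendsto_semigroupFun t.coe_nonneg x

/-- **`‖T(t)‖ ≤ 1`**: the Hille–Yosida semigroup is a contraction semigroup.
[cite: EngelNagel2000, Ch. II Thm. 3.5] -/
theorem norm_semigroup_app_le (h : IsHilleYosidaData U J) (t : ℝ≥0) : ‖h.semigroup.app t‖ ≤ 1 :=
  ContinuousLinearMap.opNorm_le_bound _ zero_le_one fun x => by
    rw [one_mul]; exact h.norm_semigroupFun_le t.coe_nonneg x

/-- The Hille–Yosida semigroup `IsContraction`. [cite: EngelNagel2000, Ch. II Thm. 3.5] -/
theorem isContraction_semigroup (h : IsHilleYosidaData U J) : h.semigroup.IsContraction :=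
  h.norm_semigroup_app_le

/-- The growth bound in Laplace-bridge shape: `‖T(t)‖ ≤ 1 · e^{0·t}` (the hypothesis `hM` of
`C0Semigroup.laplaceResolvent` with `M = 1`, `ω = 0`). [cite: EngelNagel2000, Ch. II Thm. 3.5] -/
theorem norm_semigroup_app_le_exp (h : IsHilleYosidaData U J) (t : ℝ≥0) :
    ‖h.semigroup.app t‖ ≤ 1 * Real.exp (0 * (t : ℝ)) := by
  rw [zero_mul, Real.exp_zero, mul_one]; exact h.norm_semigroup_app_le t

end IsHilleYosidaData

end HilleYosida

end Literature.Analysis.UnboundedOperators
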